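import Mathlib
import Summits.Ventures.PercRepro2.Tail2D
import Summits.Ventures.PercRepro2.Tail2DWeights

/-!
# The bundle step of the two-dimensional tail calculus (seat mine-b, cell pub-perc-repro2)

Parallel composition of a network `X` with a bundle of `c` free edges convolves the tail of `X` along the
anti-diagonal direction `w = (1, -1)` with the binomial weights:
`T'(a, b) = Σ_{i=0}^{c} C(c, i) · T(a - i, b - (c - i))`.  We prove that for ANY log-concave positive weights
`y₀, …, y_c` (`IsLCW`, Tail2DWeights.lean) the convolution `bconv y c T` of an M♮-concave tail (`IsMTail`,
Tail2D.lean) is again an M♮-concave tail (`bconv_isMTail`).  The two skew inequalities `m2`, `m4` are the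
statement that the likelihood-ratio order of two adjacent `w`-lines is preserved by a PF₂ convolution
(`lr_conv`); the log-submodularity `m1` follows from `m1` of `T` on the diagonal terms and the cross lemma
`IsMTail.cross` on the off-diagonal pairs.
-/

open Finset

namespace Summit.Ventures.PercRepro2.Tail2D

section Bundle

variable {T : ℤ → ℤ → ℝ} {L : ℤ} (hT : IsMTail T L) {y : ℤ → ℝ} {c : ℤ} (hy : IsLCW y c)

/-- the summand of the bundle convolution rewritten along a `w`-line -/
lemma bconv_eq (a b : ℤ) (g : ℤ → ℤ) (h : ℤ → ℤ) (ha : ∀ i, a - i = g i) (hb : ∀ i, b - (c - i) = h i) :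
    bconv y c T a b = ∑ i ∈ Finset.Icc 0 c, y i * T (g i) (h i) := by
  unfold bconv; refine Finset.sum_congr rfl (fun i _ => ?_); rw [ha i, hb i]

include hT hy in
/-- **the bundle step**: the log-concave-weighted convolution along the anti-diagonal direction of an
M♮-concave tail is an M♮-concave tail with top level `L + c`. -/
theorem bconv_isMTail (hc : 0 ≤ c) : IsMTail (bconv y c T) (L + c) where
  L_nonneg := by have := hT.L_nonneg; omega
  clip₁ := by
    intro a b h; unfold bconv
    refine Finset.sum_congr rfl (fun i hi => ?_)
    simp only [Finset.mem_Icc] at hi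
    rw [hT.clip₁ (a - i) _ (by omega), hT.clip₁ (0 - i) _ (by omega)]
  clip₂ := by
    intro a b h; unfold bconv
    refine Finset.sum_congr rfl (fun i hi => ?_)
    simp only [Finset.mem_Icc] at hi
    rw [hT.clip₂ (a - i) _ (by omega), hT.clip₂ (a - i) (0 - (c - i)) (by omega)]
  pos := by
    intro a b h; unfold bconv
    have hL := hT.L_nonneg
    -- the witness index
    set i₀ : ℤ := min c (max a 0) with hi₀
    have hmem : i₀ ∈ Finset.Icc 0 c := by simp only [Finset.mem_Icc]; omega
    have hpos : 0 < y i₀ * T (a - i₀) (b - (c - i₀)) := by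
      apply mul_pos (hy.pos i₀ (by omega) (by omega))
      apply hT.pos; omega
    calc (0 : ℝ) < y i₀ * T (a - i₀) (b - (c - i₀)) := hpos
      _ ≤ ∑ i ∈ Finset.Icc 0 c, y i * T (a - i) (b - (c - i)) :=
          Finset.single_le_sum (f := fun i => y i * T (a - i) (b - (c - i)))
            (fun i _ => mul_nonneg (hy.nonneg i) (hT.nonneg _ _)) hmem
  zero := by
    intro a b h; unfold bconv
    apply Finset.sum_eq_zero; intro i hi
    simp only [Finset.mem_Icc] at hi
    rw [hT.zero (a - i) (b - (c - i)) (by omega)]; ring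
  anti₁ := by
    intro a b; unfold bconv
    apply Finset.sum_le_sum; intro i _
    apply mul_le_mul_of_nonneg_left _ (hy.nonneg i)
    have := hT.anti₁ (a - i) (b - (c - i))
    rwa [show a - i + 1 = a + 1 - i by ring] at this
  anti₂ := by
    intro a b; unfold bconv
    apply Finset.sum_le_sum; intro i _
    apply mul_le_mul_of_nonneg_left _ (hy.nonneg i)
    have := hT.anti₂ (a - i) (b - (c - i))
    rwa [show b - (c - i) + 1 = b + 1 - (c - i) by ring] at this
  m2 := by
    intro a b
    -- the two adjacent w-lines through (a, b - c) and (a + 1, b - c)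
    have key := lr_conv hy (fun m => T (a + m) (b - c - m)) (fun m => T (a + 1 + m) (b - c - m))
      (fun m m' h => hT.m2_iter a (b - c) h) 0
    rw [bconv_eq (a + 2) (b - 1) (fun i => a + 1 + (0 + 1 - i)) (fun i => b - c - (0 + 1 - i))
        (fun i => by ring) (fun i => by ring),
      bconv_eq a b (fun i => a + (0 - i)) (fun i => b - c - (0 - i)) (fun i => by ring) (fun i => by ring),
      bconv_eq (a + 1) b (fun i => a + 1 + (0 - i)) (fun i => b - c - (0 - i)) (fun i => by ring) (fun i => by ring),
      bconv_eq (a + 1) (b - 1) (fun i => a + (0 + 1 - i)) (fun i => b - c - (0 + 1 - i)) (fun i => by ring) (fun i => by ring)]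
    exact key
  m4 := by
    intro a b
    -- the two adjacent w-lines through (a, b - c) and (a, b + 1 - c)
    have key := lr_conv hy (fun m => T (a + m) (b + 1 - c - m)) (fun m => T (a + m) (b - c - m))
      (fun m m' h => by
        have := hT.m4_iter a (b - c) h
        rw [show b - c + 1 - m = b + 1 - c - m by ring, show b - c + 1 - m' = b + 1 - c - m' by ring] at this
        linarith [this]) (-1)
    rw [bconv_eq (a - 1) (b + 2) (fun i => a + (-1 - i)) (fun i => b + 1 - c - (-1 - i)) (fun i => by ring) (fun i => by ring),
      bconv_eq a b (fun i => a + (-1 + 1 - i)) (fun i => b - c - (-1 + 1 - i)) (fun i => by ring) (fun i => by ring),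
      bconv_eq a (b + 1) (fun i => a + (-1 + 1 - i)) (fun i => b + 1 - c - (-1 + 1 - i)) (fun i => by ring) (fun i => by ring),
      bconv_eq (a - 1) (b + 1) (fun i => a + (-1 - i)) (fun i => b - c - (-1 - i)) (fun i => by ring) (fun i => by ring)]
    linarith [key]
  m1 := by
    intro a b
    -- the three w-lines through (a, b - c), (a + 1, b - c), (a + 2, b - c)
    rw [bconv_eq (a + 1) (b + 1) (fun i => a + 1 + (-i)) (fun i => b - c + 1 - (-i)) (fun i => by ring) (fun i => by ring),
      bconv_eq a b (fun i => a + (-i)) (fun i => b - c - (-i)) (fun i => by ring) (fun i => by ring),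
      bconv_eq (a + 1) b (fun i => a + 1 + (-i)) (fun i => b - c - (-i)) (fun i => by ring) (fun i => by ring),
      bconv_eq a (b + 1) (fun i => a + (-i)) (fun i => b - c + 1 - (-i)) (fun i => by ring) (fun i => by ring)]
    rw [Finset.sum_mul_sum, Finset.sum_mul_sum]
    set I := Finset.Icc 0 c with hI
    set X : ℤ → ℤ → ℝ := fun i j => y i * T (a + 1 + (-i)) (b - c + 1 - (-i)) * (y j * T (a + (-j)) (b - c - (-j))) with hX
    set Y : ℤ → ℤ → ℝ := fun i j => y i * T (a + 1 + (-i)) (b - c - (-i)) * (y j * T (a + (-j)) (b - c + 1 - (-j))) with hY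
    show ∑ i ∈ I, ∑ j ∈ I, X i j ≤ ∑ i ∈ I, ∑ j ∈ I, Y i j
    have hXc : ∑ i ∈ I, ∑ j ∈ I, X i j = ∑ i ∈ I, ∑ j ∈ I, X j i := Finset.sum_comm
    have hYc : ∑ i ∈ I, ∑ j ∈ I, Y i j = ∑ i ∈ I, ∑ j ∈ I, Y j i := Finset.sum_comm
    have key : ∑ i ∈ I, ∑ j ∈ I, (X i j + X j i) ≤ ∑ i ∈ I, ∑ j ∈ I, (Y i j + Y j i) := by
      apply Finset.sum_le_sum; intro i _
      apply Finset.sum_le_sum; intro j _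
      have hc := hT.cross a (b - c) (-j) (-i)
      have hyy : 0 ≤ y i * y j := mul_nonneg (hy.nonneg i) (hy.nonneg j)
      have := mul_le_mul_of_nonneg_left hc hyy
      simp only [hX, hY]
      rw [show a + 1 + (-i) = a + 1 + -i by ring, show b - c + 1 - (-i) = b - c + 1 - -i by ring] -- no-ops
      calc y i * T (a + 1 + -i) (b - c + 1 - -i) * (y j * T (a + -j) (b - c - -j))
            + y j * T (a + 1 + -j) (b - c + 1 - -j) * (y i * T (a + -i) (b - c - -i))
          = y i * y j * (T (a + 1 + -i) (b - c + 1 - -i) * T (a + -j) (b - c - -j)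
              + T (a + 1 + -j) (b - c + 1 - -j) * T (a + -i) (b - c - -i)) := by ring
        _ ≤ y i * y j * (T (a + 1 + -i) (b - c - -i) * T (a + -j) (b - c + 1 - -j)
              + T (a + 1 + -j) (b - c - -j) * T (a + -i) (b - c + 1 - -i)) := this
        _ = y i * T (a + 1 + -i) (b - c - -i) * (y j * T (a + -j) (b - c + 1 - -j))
              + y j * T (a + 1 + -j) (b - c - -j) * (y i * T (a + -i) (b - c + 1 - -i)) := by ring
    simp only [Finset.sum_add_distrib] at key
    rw [← hXc, ← hYc] at key
    linarith [key]

end Bundle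

end Summit.Ventures.PercRepro2.Tail2D
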